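import Mathlib
import Summits.ValiantsHypothesis.ValiantsHypothesis.Theses.BarrierLever
import Summits.ValiantsHypothesis.ValiantsHypothesis.Theorems.BarrierLeverDefinableEquationsStatus
import Summits.ValiantsHypothesis.ValiantsHypothesis.Theorems.BarrierLeverDefinableEquationsLevelOne
import Summits.ValiantsHypothesis.ValiantsHypothesis.Theorems.BarrierLeverDefinableEquationsVNPVersusVPSPACEDcSlice
import Summits.ValiantsHypothesis.ValiantsHypothesis.Theorems.BarrierLeverDcSliceCoversVP

/-!
# Crux `BarrierLever.DefinableEquations` (stmt-8745) ⟺ `SingleSizeEquations` (stmt-8749) —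
# NORMAL FORM: ONE level against ONE superpolynomial size bound; the `dc` shadow of the crux
# (val-np-p5 g25)

The crux `DefinableEquations` reads `∃ a ∀ b ∃ n₀ ∀ n ≥ n₀ Eq(n, b, a)`: one level `a` of
boolean-sum equations against EVERY polynomial size bound `n ^ b`, the equation being allowed to
depend on `b`.  The tree's `Status.definableEquations_of_superpolynomial` (lead c4) observes that a
single level-`a` family killing ONE superpolynomial size bound `s` implies the crux and comments
"the crux is weaker only in allowing the equation to depend on `b`".  It is not weaker: by a
diagonal choice of the size exponent (`b(n) := max {b ≤ n : n₀(b) ≤ n}`, `Nat.findGreatest`),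
the crux is EQUIVALENT to that one-family form
(`definableEquations_iff_superpolynomial`, `singleSizeEquations_iff_superpolynomial`):

  `DefinableEquations ⟺ ∃ a, ∃ s superpolynomial, ∃ n₀, ∀ n ≥ n₀,` some nonzero level-`a`
  boolean sum vanishes at `coeff f` for every `f` with `deg f ≤ n` and `L(f) ≤ s n`,

where "superpolynomial" is `∀ b ∃ n₀ ∀ n ≥ n₀, n ^ b ≤ s n`, with NO prescribed growth rate.

The `dc` shadow (`dcSlice_superpolynomial_of_definableEquations`): since
`L(f) ≤ 8 (dc f + 1)^7 + (dc f)^2 (2n+1)` (tree, `VNPVersusVPSPACE.complexity_le_of_dc_le`), the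
crux IMPLIES natural proofs at one level against the determinantal slice
`{deg f ≤ n, dc f ≤ m(n)}` for SOME superpolynomial threshold `m` — again with no prescribed growth.
Item stmt-8746 `DefinableDcEquations` is the same statement with the growth PRESCRIBED
(`m(n) ≥ 2^(C (log₂ n + 1)²)` for every `C`), which is exactly the threshold at which the converse
`DcEq ⇒ DefEq` holds by VSBR depth reduction (`dc f ≤ 2^(17 b² (log₂ n + 1)²)` on
`SmallCircuits ℂ n b`; tree `dcSliceCoversVP_proof`).  So, on the size/dc axis:

  `[∃ m super-quasi-polynomial, DcEq(m)] ⇒ DefinableEquations ⟺ SingleSizeEquations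
     ⟺ [∃ s superpolynomial, Eq at one level against L ≤ s] ⇒ [∃ m superpolynomial, DcEq(m)]`,

and the only gap between 8745 and 8746 is the growth clause (superpolynomial vs.
super-quasi-polynomial thresholds — the `VP` vs `VQP` loss of depth reduction).
Reductions only; all three items stay OPEN (Chatterjee–Tengse 2023 §1.3 dir. 2) and nothing here
bears on `VP ≠ VNP`.  No definitions, no named facts.
Refs: Forbes–Shpilka–Volk 2018 Def. 1.1; Chatterjee–Tengse arXiv:2309.07612 §1.3; Bürgisser 2000
Ch. 2 (dc vs. circuit size).
-/

set_option linter.dupNamespace false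

noncomputable section

namespace Summit.ValiantsHypothesis.ValiantsHypothesis.Theorems.BarrierLeverDefinableEquations

open MvPolynomial
open Literature.Computability.AlgebraicComplexity Literature.Barriers.ValiantsHypothesis
open Summit.ValiantsHypothesis.ValiantsHypothesis.Theses.BarrierLever
open scoped BigOperators

namespace Superpolynomial

/-! ## 1. The diagonal: from `∀ b` eventually to ONE superpolynomial size bound -/

/-- **Diagonal size exponent.**  From thresholds `n₀ : ℕ → ℕ` (level `a` kills size `n ^ b` for
`n ≥ n₀ b`) define `b(n) := Nat.findGreatest (fun b => n₀ b ≤ n) n`; then `n₀ (b n) ≤ n` once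
`n ≥ n₀ 0`, and `b ≤ b(n)` once `n ≥ max (n₀ b) b`. [folklore] -/
theorem findGreatest_threshold_spec (n₀ : ℕ → ℕ) {n : ℕ} (hn : n₀ 0 ≤ n) :
    n₀ (Nat.findGreatest (fun b => n₀ b ≤ n) n) ≤ n := by
  have h := Nat.findGreatest_spec (P := fun b => n₀ b ≤ n) (Nat.zero_le n) hn
  exact h

/-- Every fixed exponent is eventually below the diagonal exponent. [folklore] -/
theorem le_findGreatest_threshold (n₀ : ℕ → ℕ) {b n : ℕ} (hb : b ≤ n) (hn : n₀ b ≤ n) :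
    b ≤ Nat.findGreatest (fun b => n₀ b ≤ n) n :=
  Nat.le_findGreatest hb hn

/-- **`DefinableEquations` ⇒ one level-`a` family against ONE superpolynomial size bound.**
If the crux holds with level `a` and thresholds `n₀(b)`, then with the diagonal exponent
`b(n) = max {b ≤ n : n₀ b ≤ n}` the size bound `s n := n ^ b(n)` is superpolynomial
(`∀ b`, eventually `n ^ b ≤ s n`) and, for all `n ≥ n₀ 0`, the crux's own witness at `(n, b(n))`
kills every `f` with `deg f ≤ n`, `L(f) ≤ s n`.  (Converse: `Status.definableEquations_of_superpolynomial`.)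
[folklore] -/
theorem superpolynomial_of_definableEquations (h : DefinableEquations) :
    ∃ (a : ℕ) (s : ℕ → ℕ), (∀ b : ℕ, ∃ n₀ : ℕ, ∀ n ≥ n₀, n ^ b ≤ s n) ∧
      ∃ n₀ : ℕ, ∀ n ≥ n₀, ∃ q : ℕ, q ≤ (Nat.choose (2 * n) n) ^ a ∧
        ∃ H : MvPolynomial (↥(degLEMonomials n) ⊕ Fin q) ℂ,
          complexity H ≤ (Nat.choose (2 * n) n) ^ a ∧ H.totalDegree ≤ (Nat.choose (2 * n) n) ^ a ∧
          boolSum H ≠ 0 ∧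
          ∀ f : MvPolynomial (Fin n) ℂ, f.totalDegree ≤ n → complexity f ≤ s n →
            eval (coeffVector (degLEMonomials n) f) (boolSum H) = 0 := by
  obtain ⟨a, h⟩ := h
  choose n₀ hn₀ using h
  -- the diagonal exponent and the size bound
  refine ⟨a, fun n => n ^ Nat.findGreatest (fun b => n₀ b ≤ n) n, fun b => ?_, n₀ 0, fun n hn => ?_⟩
  · refine ⟨max (n₀ b) (max b 1), fun n hn => ?_⟩
    have hb : b ≤ n := le_trans (le_trans (le_max_left _ _) (le_max_right _ _)) hn
    have h1 : 1 ≤ n := le_trans (le_trans (le_max_right _ _) (le_max_right _ _)) hn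
    have hnb : n₀ b ≤ n := le_trans (le_max_left _ _) hn
    exact Nat.pow_le_pow_right h1 (le_findGreatest_threshold n₀ hb hnb)
  · have hspec : n₀ (Nat.findGreatest (fun b => n₀ b ≤ n) n) ≤ n := findGreatest_threshold_spec n₀ hn
    obtain ⟨q, hq, H, hH, hdeg, h0, hvan⟩ := hn₀ _ n hspec
    exact ⟨q, hq, H, hH, hdeg, h0, fun f hfd hfc => hvan f ⟨hfd, hfc⟩⟩

/-- **NORMAL FORM.**  The crux `DefinableEquations` (`∃ a ∀ b`, equation depending on `b`) is
EQUIVALENT to: some level `a` and ONE superpolynomial size bound `s` (`∀ b`, eventually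
`n ^ b ≤ s n`; no growth rate prescribed) such that for all large `n` a nonzero level-`a` boolean
sum vanishes at `coeff f` for every `f` of degree `≤ n` and circuit size `≤ s n`. [folklore] -/
theorem definableEquations_iff_superpolynomial :
    DefinableEquations ↔
      ∃ (a : ℕ) (s : ℕ → ℕ), (∀ b : ℕ, ∃ n₀ : ℕ, ∀ n ≥ n₀, n ^ b ≤ s n) ∧
        ∃ n₀ : ℕ, ∀ n ≥ n₀, ∃ q : ℕ, q ≤ (Nat.choose (2 * n) n) ^ a ∧
          ∃ H : MvPolynomial (↥(degLEMonomials n) ⊕ Fin q) ℂ,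
            complexity H ≤ (Nat.choose (2 * n) n) ^ a ∧ H.totalDegree ≤ (Nat.choose (2 * n) n) ^ a ∧
            boolSum H ≠ 0 ∧
            ∀ f : MvPolynomial (Fin n) ℂ, f.totalDegree ≤ n → complexity f ≤ s n →
              eval (coeffVector (degLEMonomials n) f) (boolSum H) = 0 :=
  ⟨superpolynomial_of_definableEquations, Status.definableEquations_of_superpolynomial⟩

/-- **The support item in the same normal form**: `SingleSizeEquations` (stmt-8749, `∀ b ∃ a`) is
equivalent to the one-level/one-superpolynomial-bound statement as well (the tree's
`definableEquations_iff_singleSizeEquations`, level reduction by dilation). [folklore] -/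
theorem singleSizeEquations_iff_superpolynomial :
    SingleSizeEquations ↔
      ∃ (a : ℕ) (s : ℕ → ℕ), (∀ b : ℕ, ∃ n₀ : ℕ, ∀ n ≥ n₀, n ^ b ≤ s n) ∧
        ∃ n₀ : ℕ, ∀ n ≥ n₀, ∃ q : ℕ, q ≤ (Nat.choose (2 * n) n) ^ a ∧
          ∃ H : MvPolynomial (↥(degLEMonomials n) ⊕ Fin q) ℂ,
            complexity H ≤ (Nat.choose (2 * n) n) ^ a ∧ H.totalDegree ≤ (Nat.choose (2 * n) n) ^ a ∧
            boolSum H ≠ 0 ∧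
            ∀ f : MvPolynomial (Fin n) ℂ, f.totalDegree ≤ n → complexity f ≤ s n →
              eval (coeffVector (degLEMonomials n) f) (boolSum H) = 0 :=
  definableEquations_iff_singleSizeEquations.symm.trans definableEquations_iff_superpolynomial

/-! ## 2. The `dc` shadow of the crux: one level against SOME superpolynomial determinantal slice -/

/-- Circuit size along the determinantal slice: `dc f ≤ m ⇒ L(f) ≤ 8(m+1)^7 + m²(2n+1)`, and the
right-hand side at `m = n ^ b` is at most `n ^ (7 b + 11)` for `n ≥ 2`. [folklore] -/
theorem dcCost_pow_le {n b : ℕ} (hn : 2 ≤ n) :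
    8 * (n ^ b + 1) ^ 7 + (n ^ b) ^ 2 * (2 * n + 1) ≤ n ^ (7 * b + 11) := by
  have h1 : 1 ≤ n ^ b := Nat.one_le_pow _ _ (by omega)
  have hA : 8 * (n ^ b + 1) ^ 7 ≤ n ^ (7 * b + 10) := by
    calc 8 * (n ^ b + 1) ^ 7 ≤ 8 * (2 * n ^ b) ^ 7 := by
          gcongr; omega
      _ = 2 ^ 10 * n ^ (7 * b) := by ring
      _ ≤ n ^ 10 * n ^ (7 * b) := by gcongr
      _ = n ^ (7 * b + 10) := by ring
  have hB : (n ^ b) ^ 2 * (2 * n + 1) ≤ n ^ (7 * b + 10) := by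
    calc (n ^ b) ^ 2 * (2 * n + 1) ≤ (n ^ b) ^ 2 * (2 * n * n) := by
          gcongr
          nlinarith
      _ = 2 * n ^ (2 * b + 2) := by ring
      _ ≤ n * n ^ (2 * b + 2) := by gcongr
      _ = n ^ (2 * b + 3) := by ring
      _ ≤ n ^ (7 * b + 10) := Nat.pow_le_pow_right (by omega) (by omega)
  calc 8 * (n ^ b + 1) ^ 7 + (n ^ b) ^ 2 * (2 * n + 1) ≤ n ^ (7 * b + 10) + n ^ (7 * b + 10) :=
        Nat.add_le_add hA hB
    _ = 2 * n ^ (7 * b + 10) := by ring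
    _ ≤ n * n ^ (7 * b + 10) := by gcongr
    _ = n ^ (7 * b + 11) := by ring

/-- **`DefinableEquations` ⇒ the `dc` version with SOME superpolynomial threshold.**  If the crux
holds then there are a level `a` and a superpolynomial threshold `m` (`∀ b`, eventually
`n ^ b ≤ m n`; no growth rate prescribed) such that for all large `n` a nonzero level-`a` boolean
sum vanishes at `coeff f` for every `f` with `deg f ≤ n` and `dc f ≤ m n`.  Item stmt-8746
`DefinableDcEquations` is this statement with the growth PRESCRIBED at `m(n) ≥ 2^(C(log₂ n+1)²)`
for all `C` — the threshold where the converse holds by depth reduction (`dcSliceCoversVP`).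
Mechanism: the normal form `superpolynomial_of_definableEquations` and
`L(f) ≤ 8(dc f + 1)^7 + (dc f)²(2n+1)` (`VNPVersusVPSPACE.complexity_le_of_dc_le`), with
`m(n) := max {m ≤ s n : 8(m+1)^7 + m²(2n+1) ≤ s n}`. [folklore] -/
theorem dcSlice_superpolynomial_of_definableEquations (h : DefinableEquations) :
    ∃ (a : ℕ) (m : ℕ → ℕ), (∀ b : ℕ, ∃ n₀ : ℕ, ∀ n ≥ n₀, n ^ b ≤ m n) ∧
      ∃ n₀ : ℕ, ∀ n ≥ n₀, ∃ q : ℕ, q ≤ (Nat.choose (2 * n) n) ^ a ∧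
        ∃ H : MvPolynomial (↥(degLEMonomials n) ⊕ Fin q) ℂ,
          complexity H ≤ (Nat.choose (2 * n) n) ^ a ∧ H.totalDegree ≤ (Nat.choose (2 * n) n) ^ a ∧
          boolSum H ≠ 0 ∧
          ∀ f : MvPolynomial (Fin n) ℂ, f.totalDegree ≤ n → determinantalComplexity f ≤ m n →
            eval (coeffVector (degLEMonomials n) f) (boolSum H) = 0 := by
  obtain ⟨a, s, hs, n₀, hn₀⟩ := superpolynomial_of_definableEquations h
  -- the diagonal threshold: the largest `m ≤ s n` whose determinantal cost fits under `s n`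
  let cost : ℕ → ℕ → ℕ := fun n m => 8 * (m + 1) ^ 7 + m ^ 2 * (2 * n + 1)
  let m : ℕ → ℕ := fun n => Nat.findGreatest (fun m => cost n m ≤ s n) (s n)
  -- `s n ≥ n ^ 11 ≥ cost n 0 = 8` eventually, so the threshold is admissible there
  obtain ⟨n₁, hn₁⟩ := hs 11
  refine ⟨a, m, fun b => ?_, max n₀ (max n₁ 2), fun n hn => ?_⟩
  · obtain ⟨n₂, hn₂⟩ := hs (7 * b + 11)
    refine ⟨max n₂ 2, fun n hn => ?_⟩
    have h2 : 2 ≤ n := le_trans (le_max_right _ _) hn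
    have hsn : n ^ (7 * b + 11) ≤ s n := hn₂ n (le_trans (le_max_left _ _) hn)
    have hcost : cost n (n ^ b) ≤ s n := (dcCost_pow_le h2).trans hsn
    have hle : n ^ b ≤ s n :=
      le_trans (Nat.pow_le_pow_right (by omega) (by omega)) hsn
    exact Nat.le_findGreatest hle hcost
  · have hn0 : n₀ ≤ n := le_trans (le_max_left _ _) hn
    have h2 : 2 ≤ n := le_trans (le_trans (le_max_right _ _) (le_max_right _ _)) hn
    have hs11 : n ^ 11 ≤ s n := hn₁ n (le_trans (le_trans (le_max_left _ _) (le_max_right _ _)) hn)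
    have hcost0 : cost n 0 ≤ s n := by
      have : (8 : ℕ) ≤ n ^ 11 := by
        calc (8 : ℕ) = 2 ^ 3 := by norm_num
          _ ≤ n ^ 3 := Nat.pow_le_pow_left h2 3
          _ ≤ n ^ 11 := Nat.pow_le_pow_right (by omega) (by omega)
      simp only [cost]
      omega
    have hspec : cost n (m n) ≤ s n :=
      Nat.findGreatest_spec (P := fun m => cost n m ≤ s n) (Nat.zero_le _) hcost0
    obtain ⟨q, hq, H, hH, hdeg, h0, hvan⟩ := hn₀ n hn0
    refine ⟨q, hq, H, hH, hdeg, h0, fun f hfd hdc => hvan f hfd ?_⟩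
    have hspec' : 8 * (m n + 1) ^ 7 + m n ^ 2 * (2 * n + 1) ≤ s n := by
      simpa only [cost] using hspec
    exact (VNPVersusVPSPACE.complexity_le_of_dc_le hdc).trans hspec'

/-- **The sandwich on the size / `dc` axis, recorded.**  (i) `DefinableDcEquations → DefinableEquations`
(tree: `dcSliceCoversVP_proof`, the prescribed super-quasi-polynomial growth feeding VSBR);
(ii) `DefinableEquations →` the `dc` statement with SOME superpolynomial threshold (this file).
[folklore] -/
theorem dc_sandwich :
    (DefinableDcEquations → DefinableEquations) ∧
    (DefinableEquations →
      ∃ (a : ℕ) (m : ℕ → ℕ), (∀ b : ℕ, ∃ n₀ : ℕ, ∀ n ≥ n₀, n ^ b ≤ m n) ∧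
        ∃ n₀ : ℕ, ∀ n ≥ n₀, ∃ q : ℕ, q ≤ (Nat.choose (2 * n) n) ^ a ∧
          ∃ H : MvPolynomial (↥(degLEMonomials n) ⊕ Fin q) ℂ,
            complexity H ≤ (Nat.choose (2 * n) n) ^ a ∧ H.totalDegree ≤ (Nat.choose (2 * n) n) ^ a ∧
            boolSum H ≠ 0 ∧
            ∀ f : MvPolynomial (Fin n) ℂ, f.totalDegree ≤ n → determinantalComplexity f ≤ m n →
              eval (coeffVector (degLEMonomials n) f) (boolSum H) = 0) :=
  ⟨Summit.ValiantsHypothesis.ValiantsHypothesis.Theorems.dcSliceCoversVP_proof,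
    dcSlice_superpolynomial_of_definableEquations⟩

/-! ## 3. The negation: every superpolynomial slice is an infinitely-often hitting set -/

/-- **¬DefEq in the normal form** (for refuter seats): the crux FAILS iff for every level `a`
and EVERY superpolynomial size bound `s` (`∀ b`, eventually `n ^ b ≤ s n`), for infinitely many
`n`, every nonzero level-`a` boolean sum is nonzero at the coefficient vector of some `f` with
`deg f ≤ n` and `L(f) ≤ s n` — `{deg ≤ n, L ≤ s(n)}` is a succinct hitting set against `VNP(N)`
infinitely often, for EVERY superpolynomial `s`, however slow.  Contrapositive of
`definableEquations_iff_superpolynomial`; compare `Status.not_definableEquations_iff`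
(`∀ a ∃ b`, polynomial slices). [folklore] -/
theorem not_definableEquations_iff_superpolynomial :
    ¬ DefinableEquations ↔
      ∀ (a : ℕ) (s : ℕ → ℕ), (∀ b : ℕ, ∃ n₀ : ℕ, ∀ n ≥ n₀, n ^ b ≤ s n) →
        ∀ n₀ : ℕ, ∃ n : ℕ, n₀ ≤ n ∧ ∀ q : ℕ, q ≤ (Nat.choose (2 * n) n) ^ a →
          ∀ H : MvPolynomial (↥(degLEMonomials n) ⊕ Fin q) ℂ,
            complexity H ≤ (Nat.choose (2 * n) n) ^ a → H.totalDegree ≤ (Nat.choose (2 * n) n) ^ a →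
            boolSum H ≠ 0 →
            ∃ f : MvPolynomial (Fin n) ℂ, f.totalDegree ≤ n ∧ complexity f ≤ s n ∧
              eval (coeffVector (degLEMonomials n) f) (boolSum H) ≠ 0 := by
  rw [definableEquations_iff_superpolynomial]
  constructor
  · intro h a s hs n₀
    by_contra hcon
    push Not at hcon
    refine h ⟨a, s, hs, n₀, fun n hn => ?_⟩
    obtain ⟨q, hq, H, hH, hdeg, h0, hvan⟩ := hcon n hn
    exact ⟨q, hq, H, hH, hdeg, h0, fun f hfd hfc => hvan f hfd hfc⟩
  · rintro h ⟨a, s, hs, n₀, hn₀⟩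
    obtain ⟨n, hn, hhit⟩ := h a s hs n₀
    obtain ⟨q, hq, H, hH, hdeg, h0, hvan⟩ := hn₀ n hn
    obtain ⟨f, hfd, hfc, hne⟩ := hhit q hq H hH hdeg h0
    exact hne (hvan f hfd hfc)

end Superpolynomial

end Summit.ValiantsHypothesis.ValiantsHypothesis.Theorems.BarrierLeverDefinableEquations
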